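import Literature.NumberTheory.LFunctions.GreatestRealZeroElementary
import HarnessLib

/-!
# The Deuring and Heilbronn phenomena by elementary methods (Bellotti–Puglisi 2023):
# tiny `h(−q)` forces `L(s,χ) ≈ ζ(2s)ζ(s)⁻¹∏_{p∣q}(1+p^{−s})` deep into the strip; a zero
# `1 − γ + it` of any `L(s,χ_k)` forces `L(1,χ_D) ≥ c₁ U^{−bγ} log^{−3}U` — AS PRINTED

Topic `Literature/NumberTheory/LFunctions` (namespace `Literature.NumberTheory.LFunctions`; the
paper's objects in the sub-namespace `BellottiPuglisi2023`). STATEMENT LAYER (D-0014) typed for the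
cell `parity-realchar` (SIEGEL INSTRUMENT, conditionals column: topic I.1 «class numbers» — the
Deuring direction «RH false ⟹ h(−q) → ∞ effectively», companion of `pintz1976_theorem2`'s hypothesis
`h(−D) ≤ log D/(2 log log D)` — and topic I.8 «Deuring–Heilbronn repulsion» in `L(1)`- and
`δ`-currency with the power `U^{bγ}`) and cc `landau-siegel` (§C HARVEST rows T-095/T-096, P-130,
«candidate»). Source: C. Bellotti, G. Puglisi, *Elementary methods in the study of the
Deuring–Heilbronn phenomenon*, Acta Arith. 208 (2023) 257–277 = arXiv:2201.03990 [BellottiPuglisi2023];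
typed from the held arXiv v3 (9 May 2022, `paper:arxiv-2201.03990`), §1 pp. 3–5 (statements), §3–§4
pp. 14–16 (the constants), read 2026-08-27. All constants "effective" (abstract, Theorem 2).

## What the source prints (§1, verbatim) and how it is typed

Standing (p. 1/p. 3): "`L(s, χ)` is a Dirichlet `L`-function belonging to the real primitive character
`χ` modulus `q` satisfying `χ(−1) = −1` and `h(−q)` is the number of classes of the imaginary quadratic
field `ℚ(√−q)`."

* **Theorem 1** (p. 3). "Let `η, µ > 0` be real numbers with `η > max(µ, 1)`. Given
  `ℓ = (log log q)^{−µ}`, we define the following set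
  `H(ℓ, q) = {s = σ + it : |1 − s| ≥ (log q)^{−4}, 1/2 + ℓ ≤ σ ≤ 1, |s| ≤ q^{ℓ/10}}`. If
  `h(−q) ≤ log q/(log log q)^η` then for each `s ∈ H(ℓ, q)` the relation
  `L(s, χ) = (ζ(2s)/ζ(s)) ∏_{p∣q} (1 + 1/p^s) [1 + O(exp{−(1/3)(log log q)^{η−µ}})]` holds."
  Rendered (`bellottiPuglisi2023_theorem1`): for each `η, µ` there are `C` and a threshold `q₀`
  (existential — see below) such that, over imaginary quadratic fields `K` (`d_K = −q`, `h(−q) = h_K`,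
  `χ` the odd primitive quadratic character mod `q`, pattern of `pintz1976_theorem2`):
  `‖L(s,χ) − M(s)‖ ≤ ‖M(s)‖·C·exp(−(1/3)(log log q)^{η−µ})` for `s ∈ H(ℓ,q)`,
  `M(s) = ζ(2s)ζ(s)⁻¹∏_{p∣q}(1 + p^{−s})`. The threshold `q₀` is not printed; it is forced on the
  typing because at a hypothetical zero `s` of `ζ` in `H(ℓ,q)` the main term is singular (the source's
  relation is then void and Corollary 1 says such `q` are bounded) — with `∃ q₀` the typed statement is
  implied by the printed one in every case and asserts nothing at small `q`.
* **Corollary 1** (p. 4). "If `ζ(β + iγ) = 0` with `β > 1/2`, then for every `η > 1` the relation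
  `h(−q) > log q/(log log q)^η` holds, provided that `q > q₀(β, γ, η)`." (Deuring–Mordell: RH false ⟹
  effective growth of `h(−q)` along all imaginary quadratic fields.) `bellottiPuglisi2023_corollary1`
  (PROVED: `bellottiPuglisi2023_corollary1_holds`; Theorem 1: `bellottiPuglisi2023_theorem1_holds`).
* **Theorem 2** (p. 4). "Let `L(s, χ_k)` be a Dirichlet `L`-function belonging to the real non
  principal character `χ_k` modulus `k`. Suppose that `L(s, χ_k)` has a zero `s₀ = 1 − γ + it` with
  `0 < γ < 1/4`. Then, for an arbitrary real non-principal character `χ_D mod D` (for which `χ_kχ_D` is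
  also non-principal) the inequality `L(1, χ_D) ≥ c₁/(U^{bγ} log³ U)`, for `½(1 − 3γ) < b < 1/(2γ)`
  holds, where `U = k |s₀| D` and `c₁` is an effective constant. The same result can be obtained if
  `χ_k` is a complex non principal character, provided that `0 < γ ≤ 1/8`."
  `bellottiPuglisi2023_theorem2`: `c₁` existential for each `(γ, b)` (the proof, pp. 14–16, fixes `b`,
  an auxiliary `h`, and a threshold `U ≥ U₀(γ)`; below the threshold finitely many `χ_D` occur and
  `L(1,χ_D) > 0`, so an effective `c₁(γ, b)` serves all `U` — the safe reading of "an effective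
  constant"); "`χ_kχ_D` non-principal" = the product of the two characters lifted to modulus `kD` is
  `≠ 1`.
* **Theorem 3** (p. 4). "If an `L`-function belonging to a non-principal character `χ_k` modulus `k`
  has a zero `s₀ = 1 − γ + it` with `γ < 1/4` if `χ_k` is real or `γ ≤ 1/8` if `χ_k` is complex, and
  another `L`-function belonging to the real non-principal character `χ_D` (for which `χ_kχ_D` is also
  non-principal) modulus `D` has a real exceptional zero `1 − δ`, then the inequality
  `δ > c₁/(U^{bγ} log⁵ U)` for `½(1 − 3γ) < b < 1/(2γ)` holds, where `U = k |s₀| D` and `c₁` is the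
  costant of Theorem 2." `bellottiPuglisi2023_theorem3` (any real zero `1 − δ`, `δ > 0`; `c₁`
  existential per `(γ, b)` — in print the same `c₁` as Theorem 2).
* **Corollary 3** (p. 5). "For an arbitrary `γ`, `0 < γ ≤ 1/8`, there is at most one `D`, and at most
  one primitive real character `χ_D` modulus `D`, such that `L(s, χ_D)` vanishes somewhere in the
  interval `[1 − min(γ, c₁/(32 log⁵ D · D^{bγ})), 1]` where both `c₁` and `b` have been defined in
  Theorem 2." `bellottiPuglisi2023_corollary3` ("the same character" across moduli = equal moduli and
  equal values on `ℕ`).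
* Index only: Corollary 2 (p. 4; its `U` is not defined inside the corollary's own hypotheses — a
  Linnik-type zero-free region `σ ≥ 1 − (b log U)⁻¹ log(c₁/(δ log⁵U))` for all characters mod `D`);
  the historical Theorem (Pintz) p. 3 (`γ < 0.05`, `L(1,χ_D) > 1/(140 U^{6γ} log³U)`, from Pintz's
  part IV); the remark after Theorem 2 ("a zero in `σ > 3/4` for real characters or `σ ≥ 7/8` for
  complex characters implies `h(−D) → ∞`").

## ERRATA on the Heilbronn half (2026-08-29, re-read against the arXiv LaTeX source; the named facts
## below are KEPT VERBATIM as typed and FLAGGED — never edited in place)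

* (E1, typing slip) Theorem 2 / Theorem 3 / Corollary 3 print the window
  `\frac{1}{2(1-3\gamma)} < b < \frac{1}{2\gamma}`, i.e. **`1/(2(1 − 3γ)) < b`**; the defs
  `bellottiPuglisi2023_theorem2`, `_theorem3`, `_corollary3` carry `(1 − 3γ)/2 < b`. Since
  `1/(2(1−3γ)) ≥ 1/2 > (1−3γ)/2`, the typed hypothesis is weaker and the typed facts are STRONGER than
  print.
* (E2, the printed proof does not deliver the printed window with `c₁ = c₁(γ, b)`) §3 p. 13–14: the
  bound (9) `Σ₁ ≪ 2|s₀|√k · U^{b(γ−1/2+1/2h)+1/4} log³U` keeps the factor `2|s₀|√k`, which p. 14 then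
  declares `≤ 3/10 · U^{…}` "for `U ≥ U₀(γ)`" — false uniformly (`|s₀|√k ≍ U` when `k`, `D` are bounded
  and `|t| → ∞`; correct only for FIXED `k, s₀`); (10) absorbs the error `O(U^{−(b/2h−1/4)})` of Pintz's
  Lemma 1 (part II) into `c₀U^{bγ}log³U · L(1, χ_D)` (circular); (11)–(15) keep only the compatibility
  condition `γ < 1/3 − 1/(3h)` and drop (8), which with `h < 2b` already forces `b > 1/(1 − 2γ)`;
  Corollary 3 prints `D^{bγ}` where `U = k|s₀|D ≤ D²` yields `D^{2bγ}` (cf. Pintz IV Theorem 3,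
  `D^{12ε} = D^{2·6ε}`). The printed statements are therefore NOT established by the printed proof;
  they are not refutable either (their hypothesis — an `L`-zero with real part `≥ 3/4` — is not known
  to occur). They stay NAMED FACTS here, with this flag.
* WHAT IS PROVED (tree, `HeilbronnPhenomenonWideRangeProofs.lean`): the bodies of the three facts
  VERBATIM with the window replaced by **`4/(1 − 4γ) < b`** (Theorems 2–3) resp. **`8/(1 − 4γ) < b`**
  (Corollary 3) — `bellottiPuglisi2023_theorem2_largeB`, `bellottiPuglisi2023_theorem3_largeB`,
  `bellottiPuglisi2023_corollary3_largeB` — i.e. what Pintz's method gives uniformly (trivial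
  character-sum bounds, cut at `U^{b/2}`): the paper's headline extension of Pintz's `γ < 0.05` to
  `γ < 1/4` (real `χ_k`) / `γ ≤ 1/8` (complex `χ_k`) with exponent `bγ`, for ALL `U`.
* Deuring half: Corollary 1 is NOT derivable from the typed `bellottiPuglisi2023_theorem1` (whose main
  term `ζ(2s)ζ(s)⁻¹∏…` is `0` at a zero of `ζ` by the division convention); it needs the product form
  `L(s,χ)ζ(s) = ζ(2s)∏_{p∣q}(1+p^{−s})(1+O(…))` of the printed proof (p. 10). Pintz's `σ > 3/4` version
  of Corollary 1 (p. 2 here; Pintz III p. 295) is PROVED in the tree: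
  `Pintz1976Deuring.classNumber_gt_of_riemannZeta_eq_zero` (`DeuringPhenomenonWeakMordell.lean`).
  UPDATE (2026-08-29): BOTH Deuring-half facts are DISCHARGED — `bellottiPuglisi2023_theorem1_holds`,
  `bellottiPuglisi2023_corollary1_holds` (`DeuringPhenomenonDeepStripTheoremOneProofs.lean`; the
  product form with `L(s,χ) ≠ 0 ∧ ζ(s) ≠ 0` on `H(ℓ,q)` is `BellottiPuglisi2023.theorem1_core`; §2 of
  the source is formalized in `DeuringPhenomenonDeepStripPerron.lean` (Lemma 1),
  `DeuringPhenomenonDeepStripLemmaTwo.lean` (Lemma 2), `DeuringPhenomenonDeepStripEulerChain.lean`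
  (Lemmas 5–6) and `DeuringPhenomenonDeepStripTheoremOneProofs.lean` (Lemmas 3–4, assembly)).

LABEL (cell rule): instrument / statement layer. WHAT THIS IS NOT: no claim that `ζ` or any `L(s,χ_k)`
has a zero off the critical line, nor that any field with `h(−q) ≤ log q/(log log q)^η` exists beyond
an effective bound; nothing here bears on parity. No instances, no notation, no axioms.

## References

* [BellottiPuglisi2023] Acta Arith. 208 (2023) 257–277 = arXiv:2201.03990v3: Theorem 1 (p. 3),
  Corollary 1, Theorems 2–3, Corollary 2 (p. 4), Corollary 3 (p. 5); proofs §2 (Thm 1), §3 pp. 14–16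
  (Thm 2), §4 (Thm 3).
* [Pintz1976ElementaryII] (the method; `pintz1976_theorem2` is the converse-direction companion).
-/

noncomputable section

open Complex Finset

namespace Literature.NumberTheory.LFunctions

namespace BellottiPuglisi2023

/-- The region `H(ℓ, q) = {s = σ + it : |1 − s| ≥ (log q)^{−4}, 1/2 + ℓ ≤ σ ≤ 1, |s| ≤ q^{ℓ/10}}`
with `ℓ = (log log q)^{−µ}` (real powers). [cite: BellottiPuglisi2023, Theorem 1] -/
def region (μ : ℝ) (q : ℕ) : Set ℂ :=
  {s : ℂ | (Real.log q) ^ (-(4 : ℝ)) ≤ ‖1 - s‖ ∧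
    1 / 2 + (Real.log (Real.log q)) ^ (-μ) ≤ s.re ∧ s.re ≤ 1 ∧
    ‖s‖ ≤ (q : ℝ) ^ ((Real.log (Real.log q)) ^ (-μ) / 10)}

/-- The main term `M(s) = ζ(2s) ζ(s)⁻¹ ∏_{p ∣ q} (1 + p^{−s})` of Theorem 1 (the "illusory"
`L`-function of a field with tiny class number). [cite: BellottiPuglisi2023, Theorem 1] -/
def mainTerm (q : ℕ) (s : ℂ) : ℂ :=
  riemannZeta (2 * s) / riemannZeta s * ∏ p ∈ q.primeFactors, (1 + (p : ℂ) ^ (-s))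

/-- "`χ_k χ_D` is non-principal": the product of `χ_k` (mod `k`) and `χ_D` (mod `D`), both lifted to
modulus `kD`, is not the trivial character. [cite: BellottiPuglisi2023, Theorem 2] -/
def ProductNonprincipal {k D : ℕ} [NeZero k] [NeZero D] (χk : DirichletCharacter ℂ k)
    (χD : DirichletCharacter ℂ D) : Prop :=
  DirichletCharacter.changeLevel (dvd_mul_right k D) χk *
      DirichletCharacter.changeLevel (dvd_mul_left D k) χD ≠ 1

end BellottiPuglisi2023

open BellottiPuglisi2023

/-! ### Theorem 1 and Corollary 1: the Deuring phenomenon -/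

/-- **Bellotti–Puglisi 2023, Theorem 1 (NAMED FACT, as printed, p. 3).** `η, µ > 0`, `η > max(µ, 1)`,
`ℓ = (log log q)^{−µ}`; `χ` the real primitive odd character mod `q`, `h(−q)` the class number of
`ℚ(√−q)`: "If `h(−q) ≤ log q/(log log q)^η` then for each `s ∈ H(ℓ, q)` the relation
`L(s, χ) = (ζ(2s)/ζ(s)) ∏_{p∣q}(1 + 1/p^s)[1 + O(exp{−(1/3)(log log q)^{η−µ}})]` holds." Rendered over
imaginary quadratic fields `K` (`q = |d_K|`, `h(−q) = h_K`) with `C` and a threshold `q₀` existential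
(see the module docstring for why the threshold is forced and harmless):
`‖L(s,χ) − M(s)‖ ≤ ‖M(s)‖ · C · exp(−(1/3)(log log q)^{η−µ})`. PROVED (2026-08-29, with `C = 4`):
`bellottiPuglisi2023_theorem1_holds` (`DeuringPhenomenonDeepStripTheoremOneProofs.lean`, §2 of the
source formalized in `DeuringPhenomenonDeepStripPerron/LemmaTwo/EulerChain/TheoremOneProofs.lean`).
[cite: BellottiPuglisi2023, Theorem 1] -/
def bellottiPuglisi2023_theorem1 : Prop :=
  ∀ η μ : ℝ, 0 < μ → max μ 1 < η → ∃ C : ℝ, ∃ q₀ : ℕ, ∀ (K : Type) [Field K] [NumberField K]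
    [NeZero (NumberField.discr K).natAbs], Module.finrank ℚ K = 2 → NumberField.discr K < 0 →
    q₀ ≤ (NumberField.discr K).natAbs →
    (NumberField.classNumber K : ℝ) ≤
        Real.log (NumberField.discr K).natAbs /
          Real.log (Real.log (NumberField.discr K).natAbs) ^ η →
    ∀ χ : DirichletCharacter ℂ (NumberField.discr K).natAbs,
      χ.IsQuadratic → χ.IsPrimitive → χ.Odd →
      ∀ s : ℂ, s ∈ region μ (NumberField.discr K).natAbs →
        ‖χ.LFunction s - mainTerm (NumberField.discr K).natAbs s‖ ≤
          ‖mainTerm (NumberField.discr K).natAbs s‖ * C *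
            Real.exp (-(1 / 3) * Real.log (Real.log (NumberField.discr K).natAbs) ^ (η - μ))

/-- **Bellotti–Puglisi 2023, Corollary 1 (NAMED FACT, as printed, p. 4).** "If `ζ(β + iγ) = 0` with
`β > 1/2`, then for every `η > 1` the relation `h(−q) > log q/(log log q)^η` holds, provided that
`q > q₀(β, γ, η)`." ("a new reformulation of Mordell's Theorem"; `q` ranges over the moduli of odd
real primitive characters = `|d_K|` of imaginary quadratic fields.) PROVED (2026-08-29):
`bellottiPuglisi2023_corollary1_holds` (`DeuringPhenomenonDeepStripTheoremOneProofs.lean`, from the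
product form `BellottiPuglisi2023.theorem1_core`, which also gives `L(s,χ) ≠ 0`, `ζ(s) ≠ 0` on
`H(ℓ,q)`); NOT a consequence of the typed `bellottiPuglisi2023_theorem1` alone (division convention at
a zero of `ζ`). Pintz's `β > 3/4`, `(log q)^{3/4}` version is the tree THEOREM
`Pintz1976Deuring.classNumber_gt_of_riemannZeta_eq_zero` (`DeuringPhenomenonWeakMordell.lean`).
[cite: BellottiPuglisi2023, Corollary 1] -/
def bellottiPuglisi2023_corollary1 : Prop :=
  ∀ β γ : ℝ, 1 / 2 < β → riemannZeta (β + γ * Complex.I) = 0 → ∀ η : ℝ, 1 < η →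
    ∃ q₀ : ℕ, ∀ (K : Type) [Field K] [NumberField K], Module.finrank ℚ K = 2 →
      NumberField.discr K < 0 → q₀ < (NumberField.discr K).natAbs →
        Real.log (NumberField.discr K).natAbs /
            Real.log (Real.log (NumberField.discr K).natAbs) ^ η <
          (NumberField.classNumber K : ℝ)

/-! ### Theorems 2–3 and Corollary 3: the Heilbronn phenomenon with the power `U^{bγ}` -/

/-- **Bellotti–Puglisi 2023, Theorem 2 (NAMED FACT, p. 4 — FLAGGED: window MIS-TYPED and the printed
proof is non-uniform; see the module docstring ERRATA).** `χ_k` non-principal mod `k` with a zero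
`s₀ = 1 − γ + it`, where `0 < γ < 1/4` if `χ_k` is real and `0 < γ ≤ 1/8` if `χ_k` is complex; `χ_D`
real non-principal mod `D` with `χ_kχ_D` non-principal; PRINTED window `1/(2(1 − 3γ)) < b < 1/(2γ)`
(typed below as `(1 − 3γ)/2 < b`, weaker — E1); `U = k|s₀|D`. Then "`L(1, χ_D) ≥ c₁/(U^{bγ} log³ U)`
[...] `c₁` is an effective constant." Rendered with `c₁ > 0` existential for each `(γ, b)`. `L(1, χ_D)`
real for real `χ_D`. NOT PROVED as typed (E1/E2); the same body with the window `4/(1 − 4γ) < b` is the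
tree THEOREM `bellottiPuglisi2023_theorem2_largeB` (`HeilbronnPhenomenonWideRangeProofs.lean`).
[cite: BellottiPuglisi2023, Theorem 2] -/
def bellottiPuglisi2023_theorem2 : Prop :=
  ∀ γ b : ℝ, 0 < γ → (1 - 3 * γ) / 2 < b → b < 1 / (2 * γ) → ∃ c₁ : ℝ, 0 < c₁ ∧
    ∀ (k : ℕ) [NeZero k] (χk : DirichletCharacter ℂ k), χk ≠ 1 →
      (χk.IsQuadratic ∧ γ < 1 / 4 ∨ γ ≤ 1 / 8) →
      ∀ t : ℝ, χk.LFunction (1 - γ + t * Complex.I) = 0 →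
        ∀ (D : ℕ) [NeZero D] (χD : DirichletCharacter ℂ D), χD ≠ 1 → χD.IsQuadratic →
          ProductNonprincipal χk χD →
            c₁ / (((k : ℝ) * ‖(1 - γ + t * Complex.I : ℂ)‖ * D) ^ (b * γ) *
                Real.log ((k : ℝ) * ‖(1 - γ + t * Complex.I : ℂ)‖ * D) ^ 3) ≤
              (χD.LFunction 1).re

/-- **Bellotti–Puglisi 2023, Theorem 3 (NAMED FACT, p. 4 — FLAGGED as Theorem 2: window MIS-TYPED,
printed proof non-uniform; module docstring ERRATA).** Same `χ_k`, `s₀ = 1 − γ + it`, `χ_D`, `b`, `U`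
as in Theorem 2; if moreover `L(s, χ_D)` "has a real exceptional zero `1 − δ`, then the inequality
`δ > c₁/(U^{bγ} log⁵ U)` for `1/(2(1 − 3γ)) < b < 1/(2γ)` [typed: `(1 − 3γ)/2 < b`] holds, where
`U = k|s₀|D` and `c₁` is the costant of Theorem 2." Rendered for every real zero `1 − δ` (`δ > 0`) of
`L(s,χ_D)`, with `c₁ > 0` existential per `(γ, b)`. NOT PROVED as typed; the same body with the window
`4/(1 − 4γ) < b` is the tree THEOREM `bellottiPuglisi2023_theorem3_largeB` (Theorem 2′ + Page's step
`L(1,χ_D)/δ ≤ log²D`). [cite: BellottiPuglisi2023, Theorem 3] -/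
def bellottiPuglisi2023_theorem3 : Prop :=
  ∀ γ b : ℝ, 0 < γ → (1 - 3 * γ) / 2 < b → b < 1 / (2 * γ) → ∃ c₁ : ℝ, 0 < c₁ ∧
    ∀ (k : ℕ) [NeZero k] (χk : DirichletCharacter ℂ k), χk ≠ 1 →
      (χk.IsQuadratic ∧ γ < 1 / 4 ∨ γ ≤ 1 / 8) →
      ∀ t : ℝ, χk.LFunction (1 - γ + t * Complex.I) = 0 →
        ∀ (D : ℕ) [NeZero D] (χD : DirichletCharacter ℂ D), χD ≠ 1 → χD.IsQuadratic →
          ProductNonprincipal χk χD →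
            ∀ δ : ℝ, 0 < δ → χD.LFunction ((1 - δ : ℝ) : ℂ) = 0 →
              c₁ / (((k : ℝ) * ‖(1 - γ + t * Complex.I : ℂ)‖ * D) ^ (b * γ) *
                  Real.log ((k : ℝ) * ‖(1 - γ + t * Complex.I : ℂ)‖ * D) ^ 5) < δ

/-- **Bellotti–Puglisi 2023, Corollary 3 (NAMED FACT, p. 5 — FLAGGED as Theorem 2; module docstring
ERRATA, incl. the printed `D^{bγ}` vs the `D^{2bγ}` that `U ≤ D²` yields).** "For an arbitrary `γ`,
`0 < γ ≤ 1/8`, there is at most one `D`, and at most one primitive real character `χ_D` modulus `D`,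
such that `L(s, χ_D)` vanishes somewhere in the interval `[1 − min(γ, c₁/(32 log⁵D · D^{bγ})), 1]`
where both `c₁` and `b` have been defined in Theorem 2." Rendered: for `0 < γ ≤ 1/8` and
`(1 − 3γ)/2 < b < 1/(2γ)` [print: `1/(2(1−3γ)) < b`] there is `c₁ > 0` such that two primitive
quadratic characters `χ₁ mod D₁`, `χ₂ mod D₂`, each with a real zero in its window, have `D₁ = D₂` and
the same values. NOT PROVED as typed; the same body with the window `8/(1 − 4γ) < b` is the tree
THEOREM `bellottiPuglisi2023_corollary3_largeB` (Theorem 3′ at `b/2`; no proof of the corollary is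
printed). [cite: BellottiPuglisi2023, Corollary 3] -/
def bellottiPuglisi2023_corollary3 : Prop :=
  ∀ γ b : ℝ, 0 < γ → γ ≤ 1 / 8 → (1 - 3 * γ) / 2 < b → b < 1 / (2 * γ) → ∃ c₁ : ℝ, 0 < c₁ ∧
    ∀ (D₁ : ℕ) [NeZero D₁] (χ₁ : DirichletCharacter ℂ D₁) (D₂ : ℕ) [NeZero D₂]
      (χ₂ : DirichletCharacter ℂ D₂),
      χ₁.IsQuadratic → χ₁.IsPrimitive → χ₁ ≠ 1 → χ₂.IsQuadratic → χ₂.IsPrimitive → χ₂ ≠ 1 →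
      (∃ σ₁ : ℝ, 1 - min γ (c₁ / (32 * Real.log D₁ ^ 5 * (D₁ : ℝ) ^ (b * γ))) ≤ σ₁ ∧ σ₁ ≤ 1 ∧
          χ₁.LFunction (σ₁ : ℂ) = 0) →
      (∃ σ₂ : ℝ, 1 - min γ (c₁ / (32 * Real.log D₂ ^ 5 * (D₂ : ℝ) ^ (b * γ))) ≤ σ₂ ∧ σ₂ ≤ 1 ∧
          χ₂.LFunction (σ₂ : ℂ) = 0) →
        D₁ = D₂ ∧ ∀ n : ℕ, χ₁ (n : ZMod D₁) = χ₂ (n : ZMod D₂)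

/-! ### PROVED reading -/

namespace BellottiPuglisi2023

/-- **Corollary 1 contraposed, in words**: if along imaginary quadratic fields of arbitrarily large
discriminant the class number stays `≤ log q/(log log q)^η` for some `η > 1` (e.g. under the
hypothesis of `pintz1976_theorem2` infinitely often), then `ζ(s) ≠ 0` for `Re s > 1/2` — the Riemann
Hypothesis for `ζ` follows. [cite: BellottiPuglisi2023, Corollary 1] -/
theorem riemannZeta_ne_zero_of_frequently_small_classNumber (h : bellottiPuglisi2023_corollary1)
    {η : ℝ} (hη : 1 < η)
    (hsmall : ∀ q₀ : ℕ, ∃ (K : Type) (_ : Field K) (_ : NumberField K),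
      Module.finrank ℚ K = 2 ∧ NumberField.discr K < 0 ∧ q₀ < (NumberField.discr K).natAbs ∧
        (NumberField.classNumber K : ℝ) ≤
          Real.log (NumberField.discr K).natAbs /
            Real.log (Real.log (NumberField.discr K).natAbs) ^ η)
    {s : ℂ} (hs : 1 / 2 < s.re) : riemannZeta s ≠ 0 := by
  intro hz
  have hs' : riemannZeta (s.re + s.im * Complex.I) = 0 := by
    rw [Complex.re_add_im s] at *
    simpa using hz
  obtain ⟨q₀, hq₀⟩ := h s.re s.im hs hs' η hη
  obtain ⟨K, _, _, h2, hneg, hq, hle⟩ := hsmall q₀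
  exact absurd (hq₀ K h2 hneg hq) (not_lt.mpr hle)

end BellottiPuglisi2023

end Literature.NumberTheory.LFunctions

end
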